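import Mathlib
import HarnessLib
import Summits.Ventures.LatticeQCDFlow.Exactness.CabibboMarinariORSweep
import Summits.Ventures.LatticeQCDFlow.Exactness.OpenBoundaryWilsonAction
import Summits.Ventures.LatticeQCDFlow.Scoring.WeightedStapleSum

/-!
# The engine's over-relaxation with WEIGHTED staples is exact for every plaquette-weighted Wilson action, and the weighted `'hb' + n_or × 'or'` composite converges from every start (open boundaries, PTBC defect)

HONEST FRAMING: exact (Metropolis-corrected) sampling algorithms for lattice gauge theory;
figures of merit are autocorrelation/cost numbers at stated couplings and volumes; no
continuum-physics claim.

Venture `LatticeQCDFlow` (cell pub-lqcd), topic `Exactness`, FANOUT row 21 (`su3-base`: open boundary conditions =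
the plaquette weights `obcWeight τ` of `OpenBoundaryWilsonAction`; the engine `latflow.core.gauge4d`: "HB/OR/Metropolis/HMC/
flow all honour it (staple sums are weighted)" — rows 22–24's PTBC defect is the same mechanism with the weights `c(q)`).
NEW WORK of the cell over the tree (row 9's `CabibboMarinariORSweep`: the one-link OR hit `cmOR e R` is measurable,
Haar-preserving and conserves `Re tr (g R)`; the UNIT-weight lattice hit `cmLatOR`, its invariance and the composite
theorem; `CabibboMarinariLatticeErgodic.latSweep_comp_uniformlyErgodic`; `CPNOverrelaxation.siteUpdateMap_invariant`;
row 21's `Scoring/WeightedStapleSum`: `weightedStapleSum`, `weightedStapleSum_mulSingle_self`,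
`weightedWilsonAction_mulSingle_sub` — the exact local difference for every weight; `PTBCWilsonDefect`:
`weightedWilsonAction`, `continuous_weightedWilsonAction`, whose NOT-CLAIMED line "that HB/OR of the engine with WEIGHTED
staples is the exact heat bath for the weighted action" this file settles for the OR half and the composite).
Nothing is cited as a fact; no number.  (`G = SU(N)` in the defining representation `suRep N`, torus `(ℤ/L)^d`, `L ≥ 2`,
ANY weights `w : Plaquette d L → ℝ`, any real `β`.)

* §1 `latStapleW w U l = R^w_l(U)` (continuous; `latStapleW_update`: independent of `U_l`);
  `weightedWilsonAction_update_sub` — `S_w(update U l g') − S_w(update U l g) = Re tr (g R^w_l) − Re tr (g' R^w_l)`.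
* §2 **`cmLatORW w l e`** — THE ENGINE'S WEIGHTED OR HIT at link `l` in frame `e` (overwrite `U_l` by
  `cmOR e (R^w_l(U)) U_l`) as a deterministic kernel; **`cmLatORW_invariant`** — it leaves `e^{−βS_w}·Haar^{⊗E}`
  invariant for every real `β` and EVERY weight (Tonelli along the link: Haar of the link is preserved by `cmOR`, and
  `S_w` is conserved because the hit conserves `Re tr (U_l R^w_l)` and `R^w_l` does not read `U_l`).
* §3 **`cmORSweepW w sched`** — any schedule of weighted hits is exact (`cmORSweepW_invariant`).
* §4 **`weighted_cmHeatBath_orSweep_uniformlyErgodic`** — a Cabibbo–Marinari heat-bath sweep for the density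
  `e^{−βS_w}` (all subgroup pairs lexicographically or reversed, every link) followed by any weighted OR schedule
  satisfies `|μ₀Kᵗ(A) − (Z⁻¹e^{−βS_w}·Haar^⊗)(A)| ≤ (1 − ε)ᵗ` for some `ε > 0`, EVERY initial law, every `t`, every `A`;
  **`weightedGibbs_unique_invariant_cmHeatBath_orSweepW`**; the open-boundary instances
  **`obc_cmHeatBath_orSweep_uniformlyErgodic`** / `obcGibbs_unique_invariant_cmHeatBath_orSweepW` (`w = obcWeight τ`).

NOT CLAIMED: OR alone (exact, never ergodic); the `'metro' + 'or'` composite; `L = 1`; rates; floating point.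
-/

noncomputable section

namespace Summit.Ventures.LatticeQCDFlow.Exactness

open MeasureTheory ProbabilityTheory Matrix Function
open Literature.MathematicalPhysics.QuantumFieldTheory
open Summit.Ventures.LatticeQCDFlow.Scoring (weightedStapleSum weightedStapleSum_mulSingle_self
  weightedWilsonAction_mulSingle_sub continuous_weightedStapleSum)
open scoped ENNReal

/-! ## §1 The weighted staple of a link on `SU(N)` configurations -/

section Lattice

variable {d L N : ℕ} {m : Type*} [Fintype m] [DecidableEq m] (w : Plaquette d L → ℝ)

/-- **The weighted staple sum of a link** in the defining representation, as a function of the configuration. -/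
def latStapleW (U : GaugeConfig d L (Matrix.specialUnitaryGroup (Fin N) ℂ)) (l : Edge d L) :
    Matrix (Fin N) (Fin N) ℂ :=
  weightedStapleSum w (suRep N) U l.1 l.2

/-- The weighted staple sum depends continuously on the configuration. -/
theorem continuous_latStapleW (l : Edge d L) :
    Continuous fun U : GaugeConfig d L (Matrix.specialUnitaryGroup (Fin N) ℂ) => latStapleW w U l :=
  continuous_weightedStapleSum w (suRep N) continuous_suRep l.1 l.2

variable [NeZero L]

/-- **The weighted staple sum does not read its own link** (`L ≥ 2`): `R^w_l(update U l g) = R^w_l(U)`. -/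
theorem latStapleW_update (hL : 2 ≤ L) (U : GaugeConfig d L (Matrix.specialUnitaryGroup (Fin N) ℂ))
    (l : Edge d L) (g : Matrix.specialUnitaryGroup (Fin N) ℂ) :
    latStapleW w (update U l g) l = latStapleW w U l := by
  obtain ⟨x, μ⟩ := l
  rw [latStapleW, latStapleW, update_eq_mulSingle_mul]
  exact weightedStapleSum_mulSingle_self w (suRep N) hL U x μ _

/-- **The weighted action along one link**: `S_w(update U l g') − S_w(update U l g) = Re tr (g R^w_l) − Re tr (g' R^w_l)`
(`L ≥ 2`). -/
theorem weightedWilsonAction_update_sub (hL : 2 ≤ L) (U : GaugeConfig d L (Matrix.specialUnitaryGroup (Fin N) ℂ))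
    (l : Edge d L) (g g' : Matrix.specialUnitaryGroup (Fin N) ℂ) :
    weightedWilsonAction w (suRep N) (update U l g') - weightedWilsonAction w (suRep N) (update U l g) =
      (((g : Matrix (Fin N) (Fin N) ℂ) * latStapleW w U l).trace).re -
        (((g' : Matrix (Fin N) (Fin N) ℂ) * latStapleW w U l).trace).re := by
  obtain ⟨x, μ⟩ := l
  have hupd : update U (x, μ) g' = Pi.mulSingle (x, μ) (g' * g⁻¹) * update U (x, μ) g := by
    have h := update_eq_mulSingle_mul (update U (x, μ) g) (x, μ) g'
    rwa [update_idem, update_self] at h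
  rw [hupd, weightedWilsonAction_mulSingle_sub w (suRep N) hL continuous_suRep (update U (x, μ) g) x μ (g' * g⁻¹),
    update_self, inv_mul_cancel_right, ← latStapleW_update w hL U (x, μ) g]
  rfl

variable (β : ℝ)

/-! ## §2 The weighted lattice OR hit is exact -/

/-- **THE ENGINE'S WEIGHTED OR HIT** at link `l` in the subgroup frame `e`: overwrite `U_l` by `cmOR e (R^w_l(U)) U_l`,
as a deterministic Markov kernel on `SU(N)^E`. -/
def cmLatORW (l : Edge d L) (e : Fin N ≃ Fin 2 ⊕ m) :
    Kernel (GaugeConfig d L (Matrix.specialUnitaryGroup (Fin N) ℂ))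
      (GaugeConfig d L (Matrix.specialUnitaryGroup (Fin N) ℂ)) :=
  Kernel.deterministic
    (siteUpdateMap (X := fun _ : Edge d L => Matrix.specialUnitaryGroup (Fin N) ℂ) l
      fun U g => cmOR e (latStapleW w U l) g)
    (measurable_siteUpdateMap (X := fun _ : Edge d L => Matrix.specialUnitaryGroup (Fin N) ℂ)
      (measurable_cmOR_uncurry e (Rf := fun U => latStapleW w U l) (continuous_latStapleW w l)))

/-- The weighted OR hit is a Markov kernel. -/
instance isMarkovKernel_cmLatORW (l : Edge d L) (e : Fin N ≃ Fin 2 ⊕ m) :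
    IsMarkovKernel (cmLatORW (d := d) (L := L) w l e) := by
  unfold cmLatORW; infer_instance

/-- `β S_w` is continuous. -/
theorem continuous_smul_weightedWilsonAction_sun :
    Continuous fun U : GaugeConfig d L (Matrix.specialUnitaryGroup (Fin N) ℂ) => β * weightedWilsonAction w (suRep N) U :=
  continuous_const.mul (continuous_weightedWilsonAction w (suRep N) continuous_suRep)

/-- **THE WEIGHTED OR HIT IS EXACT** (`L ≥ 2`): it leaves `e^{−βS_w} · Haar^{⊗E}` invariant, for every real `β`, every
weight, every link and every frame. -/
theorem cmLatORW_invariant (hL : 2 ≤ L) (l : Edge d L) (e : Fin N ≃ Fin 2 ⊕ m) :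
    Kernel.Invariant (cmLatORW (d := d) (L := L) w l e)
      ((Measure.pi (linkHaar (Edge d L) (Fin N))).withDensity
        (gibbsDensity fun U : GaugeConfig d L (Matrix.specialUnitaryGroup (Fin N) ℂ) =>
          β * weightedWilsonAction w (suRep N) U)) := by
  refine siteUpdateMap_invariant (X := fun _ : Edge d L => Matrix.specialUnitaryGroup (Fin N) ℂ)
    (μ := linkHaar (Edge d L) (Fin N))
    (measurable_cmOR_uncurry e (Rf := fun U => latStapleW w U l) (continuous_latStapleW w l))
    (fun U ξ => ?_) (fun U => ?_)
    (measurable_gibbsDensity (continuous_smul_weightedWilsonAction_sun w β)) (fun U ξ => ?_)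
  · funext g
    rw [latStapleW_update w hL]
  · exact (measurePreserving_cmOR e (latStapleW w U l)).map_eq
  · have h := weightedWilsonAction_update_sub w hL U l ξ (cmOR e (latStapleW w U l) ξ)
    rw [re_trace_cmOR_mul, sub_self] at h
    have hS : weightedWilsonAction w (suRep N) (update U l (cmOR e (latStapleW w U l) ξ)) =
        weightedWilsonAction w (suRep N) (update U l ξ) := by linarith
    show gibbsDensity _ (update U l (cmOR e (latStapleW w U l) ξ)) = gibbsDensity _ (update U l ξ)
    simp only [gibbsDensity, hS]

/-! ## §3 Weighted OR sweeps -/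

/-- **A weighted over-relaxation sweep**: the cycle of weighted hits along any schedule of (link, frame) pairs. -/
def cmORSweepW (sched : List (Edge d L × (Fin N ≃ Fin 2 ⊕ m))) :
    Kernel (GaugeConfig d L (Matrix.specialUnitaryGroup (Fin N) ℂ))
      (GaugeConfig d L (Matrix.specialUnitaryGroup (Fin N) ℂ)) :=
  cycle (sched.map fun p => cmLatORW w p.1 p.2)

/-- A weighted OR sweep is a Markov kernel. -/
instance isMarkovKernel_cmORSweepW (sched : List (Edge d L × (Fin N ≃ Fin 2 ⊕ m))) :
    IsMarkovKernel (cmORSweepW (d := d) (L := L) w sched) := by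
  unfold cmORSweepW
  refine isMarkovKernel_cycle fun κ hκ => ?_
  obtain ⟨p, -, rfl⟩ := List.mem_map.1 hκ
  infer_instance

/-- **Every weighted OR sweep is exact** for `e^{−βS_w} · Haar^{⊗E}` (`L ≥ 2`). -/
theorem cmORSweepW_invariant (hL : 2 ≤ L) (sched : List (Edge d L × (Fin N ≃ Fin 2 ⊕ m))) :
    Kernel.Invariant (cmORSweepW (d := d) (L := L) w sched)
      ((Measure.pi (linkHaar (Edge d L) (Fin N))).withDensity
        (gibbsDensity fun U : GaugeConfig d L (Matrix.specialUnitaryGroup (Fin N) ℂ) =>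
          β * weightedWilsonAction w (suRep N) U)) := by
  unfold cmORSweepW
  refine invariant_cycle fun κ hκ => ?_
  obtain ⟨p, -, rfl⟩ := List.mem_map.1 hκ
  exact cmLatORW_invariant w β hL p.1 p.2

/-! ## §4 Heat-bath sweep for `e^{−βS_w}`, then weighted OR sweeps: convergence from every start -/

variable [NeZero N]

/-- **THE WEIGHTED `'hb' + n_or × 'or'` COMPOSITE CONVERGES TO THE WEIGHTED GIBBS LAW FROM EVERY START.**  Torus
`(ℤ/L)^d` with `L ≥ 2`, `SU(N)` in the defining representation, any real `β`, ANY plaquette weights `w`: one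
Cabibbo–Marinari heat-bath sweep for the density `e^{−βS_w}` (all subgroup pairs lexicographically or reversed, every
link visited) followed by ANY weighted over-relaxation schedule satisfies, for some `ε > 0`,
`|μ₀Kᵗ(A) − (Z⁻¹e^{−βS_w}·Haar^⊗)(A)| ≤ (1 − ε)ᵗ` for every initial law `μ₀`, every `t`, every set `A`. -/
theorem weighted_cmHeatBath_orSweep_uniformlyErgodic (hL : 2 ≤ L) (frames : List (Fin N ≃ Fin 2 ⊕ m))
    (hlex : frames.map pairOf = lexPairs (Finset.univ.sort (· ≤ ·) : List (Fin N)) ∨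
      frames.map pairOf = (lexPairs (Finset.univ.sort (· ≤ ·) : List (Fin N))).reverse)
    {links : List (Edge d L)} (hl : ∀ l, l ∈ links) (sched : List (Edge d L × (Fin N ≃ Fin 2 ⊕ m))) :
    ∃ ε : ℝ, 0 < ε ∧ ∀ (μ₀ : Measure (GaugeConfig d L (Matrix.specialUnitaryGroup (Fin N) ℂ)))
      [IsProbabilityMeasure μ₀] (t : ℕ) (A : Set (GaugeConfig d L (Matrix.specialUnitaryGroup (Fin N) ℂ))),
      |((fun ν : Measure (GaugeConfig d L (Matrix.specialUnitaryGroup (Fin N) ℂ)) =>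
          ν.bind (cmORSweepW w sched ∘ₖ latSweep (gibbsDensity fun U => β * weightedWilsonAction w (suRep N) U)
            frames links))^[t] μ₀).real A
        - (piGibbsLaw (linkHaar (Edge d L) (Fin N))
            (gibbsDensity fun U => β * weightedWilsonAction w (suRep N) U)).real A| ≤ (1 - ε) ^ t := by
  have hS := continuous_smul_weightedWilsonAction_sun (d := d) (L := L) (N := N) w β
  obtain ⟨ωa, -, hmin⟩ := isCompact_univ.exists_isMinOn
    (Set.univ_nonempty (α := GaugeConfig d L (Matrix.specialUnitaryGroup (Fin N) ℂ))) hS.continuousOn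
  obtain ⟨ωb, -, hmax⟩ := isCompact_univ.exists_isMaxOn
    (Set.univ_nonempty (α := GaugeConfig d L (Matrix.specialUnitaryGroup (Fin N) ℂ))) hS.continuousOn
  have hωa : ∀ ω, β * weightedWilsonAction w (suRep N) ωa ≤ β * weightedWilsonAction w (suRep N) ω := fun ω =>
    (isMinOn_iff.1 hmin) ω (Set.mem_univ ω)
  have hωb : ∀ ω, β * weightedWilsonAction w (suRep N) ω ≤ β * weightedWilsonAction w (suRep N) ωb := fun ω =>
    (isMaxOn_iff.1 hmax) ω (Set.mem_univ ω)
  exact latSweep_comp_uniformlyErgodic (measurable_gibbsDensity hS)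
    (by rw [Ne, ENNReal.ofReal_eq_zero, not_le]; exact Real.exp_pos _) ENNReal.ofReal_ne_top
    (fun ω => (gibbsDensity_bounds hωa hωb ω).1) (fun ω => (gibbsDensity_bounds hωa hωb ω).2)
    frames hlex hl (cmORSweepW w sched) (cmORSweepW_invariant w β hL sched)

/-- **The weighted Gibbs law is the unique invariant probability law of the weighted `'hb' + 'or'` composite.** -/
theorem weightedGibbs_unique_invariant_cmHeatBath_orSweepW (hL : 2 ≤ L) (frames : List (Fin N ≃ Fin 2 ⊕ m))
    (hlex : frames.map pairOf = lexPairs (Finset.univ.sort (· ≤ ·) : List (Fin N)) ∨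
      frames.map pairOf = (lexPairs (Finset.univ.sort (· ≤ ·) : List (Fin N))).reverse)
    {links : List (Edge d L)} (hl : ∀ l, l ∈ links) (sched : List (Edge d L × (Fin N ≃ Fin 2 ⊕ m)))
    {π' : Measure (GaugeConfig d L (Matrix.specialUnitaryGroup (Fin N) ℂ))} [IsProbabilityMeasure π']
    (hπ' : Kernel.Invariant (cmORSweepW w sched ∘ₖ
      latSweep (gibbsDensity fun U => β * weightedWilsonAction w (suRep N) U) frames links) π') :
    π' = piGibbsLaw (linkHaar (Edge d L) (Fin N)) (gibbsDensity fun U => β * weightedWilsonAction w (suRep N) U) := by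
  have hS := continuous_smul_weightedWilsonAction_sun (d := d) (L := L) (N := N) w β
  obtain ⟨ωa, -, hmin⟩ := isCompact_univ.exists_isMinOn
    (Set.univ_nonempty (α := GaugeConfig d L (Matrix.specialUnitaryGroup (Fin N) ℂ))) hS.continuousOn
  obtain ⟨ωb, -, hmax⟩ := isCompact_univ.exists_isMaxOn
    (Set.univ_nonempty (α := GaugeConfig d L (Matrix.specialUnitaryGroup (Fin N) ℂ))) hS.continuousOn
  have hωa : ∀ ω, β * weightedWilsonAction w (suRep N) ωa ≤ β * weightedWilsonAction w (suRep N) ω := fun ω =>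
    (isMinOn_iff.1 hmin) ω (Set.mem_univ ω)
  have hωb : ∀ ω, β * weightedWilsonAction w (suRep N) ω ≤ β * weightedWilsonAction w (suRep N) ωb := fun ω =>
    (isMaxOn_iff.1 hmax) ω (Set.mem_univ ω)
  have hp : Measurable (gibbsDensity fun U : GaugeConfig d L (Matrix.specialUnitaryGroup (Fin N) ℂ) =>
      β * weightedWilsonAction w (suRep N) U) := measurable_gibbsDensity hS
  have hm0 : ENNReal.ofReal (Real.exp (-(β * weightedWilsonAction w (suRep N) ωb))) ≠ 0 := by
    rw [Ne, ENNReal.ofReal_eq_zero, not_le]; exact Real.exp_pos _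
  have hmp := fun ω => (gibbsDensity_bounds hωa hωb ω).1
  have hpM := fun ω => (gibbsDensity_bounds hωa hωb ω).2
  obtain ⟨ε, hε, hmin'⟩ := latSweep_minorised hp hm0 ENNReal.ofReal_ne_top hmp hpM frames hlex hl
  haveI := isMarkovKernel_latSweep hp hm0 ENNReal.ofReal_ne_top hmp hpM frames links
  haveI := isProbabilityMeasure_piGibbsLaw (μ := linkHaar (Edge d L) (Fin N)) hm0 ENNReal.ofReal_ne_top hmp hpM
  haveI : IsProbabilityMeasure ((Measure.pi (linkHaar (Edge d L) (Fin N))).bind (cmORSweepW (d := d) (L := L) w sched)) :=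
    ⟨by rw [Measure.bind_apply MeasurableSet.univ (Kernel.aemeasurable _)]; simp⟩
  have hmin'' := fun a => minorised_comp_left hmin' (cmORSweepW w sched) a
  have hinv : Kernel.Invariant (cmORSweepW w sched ∘ₖ
      latSweep (gibbsDensity fun U => β * weightedWilsonAction w (suRep N) U) frames links)
      (piGibbsLaw (linkHaar (Edge d L) (Fin N)) (gibbsDensity fun U => β * weightedWilsonAction w (suRep N) U)) :=
    (invariant_smul (cmORSweepW_invariant w β hL sched) _).comp
      (latSweep_invariant_piGibbsLaw hp hm0 ENNReal.ofReal_ne_top hmp hpM frames links)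
  exact invariant_unique_of_minorised hmin'' (pos_iff_ne_zero.2 hε) hinv hπ'

/-- **OPEN BOUNDARIES**: the heat-bath sweep for `e^{−βS_OBC}` followed by any open-boundary-weighted OR schedule
converges to the open-boundary Gibbs law from every start (time direction `τ`, `L ≥ 2`). -/
theorem obc_cmHeatBath_orSweep_uniformlyErgodic (hL : 2 ≤ L) (τ : Fin d) (frames : List (Fin N ≃ Fin 2 ⊕ m))
    (hlex : frames.map pairOf = lexPairs (Finset.univ.sort (· ≤ ·) : List (Fin N)) ∨
      frames.map pairOf = (lexPairs (Finset.univ.sort (· ≤ ·) : List (Fin N))).reverse)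
    {links : List (Edge d L)} (hl : ∀ l, l ∈ links) (sched : List (Edge d L × (Fin N ≃ Fin 2 ⊕ m))) :
    ∃ ε : ℝ, 0 < ε ∧ ∀ (μ₀ : Measure (GaugeConfig d L (Matrix.specialUnitaryGroup (Fin N) ℂ)))
      [IsProbabilityMeasure μ₀] (t : ℕ) (A : Set (GaugeConfig d L (Matrix.specialUnitaryGroup (Fin N) ℂ))),
      |((fun ν : Measure (GaugeConfig d L (Matrix.specialUnitaryGroup (Fin N) ℂ)) =>
          ν.bind (cmORSweepW (obcWeight τ) sched ∘ₖ latSweep (gibbsDensity fun U => β * obcAction (suRep N) τ U)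
            frames links))^[t] μ₀).real A
        - (piGibbsLaw (linkHaar (Edge d L) (Fin N)) (gibbsDensity fun U => β * obcAction (suRep N) τ U)).real A|
          ≤ (1 - ε) ^ t :=
  weighted_cmHeatBath_orSweep_uniformlyErgodic (obcWeight τ) β hL frames hlex hl sched

/-- … and the open-boundary Gibbs law is its ONLY invariant probability law. -/
theorem obcGibbs_unique_invariant_cmHeatBath_orSweepW (hL : 2 ≤ L) (τ : Fin d) (frames : List (Fin N ≃ Fin 2 ⊕ m))
    (hlex : frames.map pairOf = lexPairs (Finset.univ.sort (· ≤ ·) : List (Fin N)) ∨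
      frames.map pairOf = (lexPairs (Finset.univ.sort (· ≤ ·) : List (Fin N))).reverse)
    {links : List (Edge d L)} (hl : ∀ l, l ∈ links) (sched : List (Edge d L × (Fin N ≃ Fin 2 ⊕ m)))
    {π' : Measure (GaugeConfig d L (Matrix.specialUnitaryGroup (Fin N) ℂ))} [IsProbabilityMeasure π']
    (hπ' : Kernel.Invariant (cmORSweepW (obcWeight τ) sched ∘ₖ
      latSweep (gibbsDensity fun U => β * obcAction (suRep N) τ U) frames links) π') :
    π' = piGibbsLaw (linkHaar (Edge d L) (Fin N)) (gibbsDensity fun U => β * obcAction (suRep N) τ U) :=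
  weightedGibbs_unique_invariant_cmHeatBath_orSweepW (obcWeight τ) β hL frames hlex hl sched hπ'

end Lattice

end Summit.Ventures.LatticeQCDFlow.Exactness
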